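import Literature.NumberTheory.Automorphic.GKModulePhiStandardRep
import Literature.NumberTheory.Automorphic.GKModulePiTensor
import Literature.NumberTheory.Automorphic.GKModuleSubrepTwist
import Literature.NumberTheory.Automorphic.ArchEmbeddingExtension
import Literature.NumberTheory.Automorphic.BianchiOrdinaryClassicality
import HarnessLib

/-!
# The archimedean coefficient module `E_wt(ℂ) = ⨂_τ V_wt(ℂ) ∘ GL_n(τ̃)` as a `(𝔤, K_∞)`-module

Topic `NumberTheory/Automorphic`; namespace `Literature.NumberTheory.Automorphic.ParallelWeight`
(the grouping namespace of the Betti coefficients `ParallelWeight.coeffRep` of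
`BianchiOrdinaryClassicality`).  Definitions with bodies and theorems; no named fact, no instance,
no `sorry`.

For a number field `F`, `n`, and a weight `wt : Fin n → ℤ`, the Betti cohomology
`H^q(X_U, Ṽ_wt)` of the arithmetic quotients of `Res_{F/ℚ} GL_n` (`ParallelWeight.cohomology`) has
coefficients the rational representation `ParallelWeight.coeffRep E F n wt = ⨂_{τ : F → E} V_wt(E) ∘
GL_n(τ)` of `GL_n(F)`.  The Eichler–Shimura–Borel–Wallach comparison with relative Lie algebra
cohomology `H^q(𝔤, K_∞; π_∞ ⊗ E_wt)` (`AutomorphicRepCohomologyCoeff`) needs these coefficients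
as a `(𝔤, K_∞)`-module `E_wt(ℂ)` of `G_∞ = GL_n(F_∞)` whose restriction to `GL_n(F) ⊆ G_∞` is the
Betti system.  This file builds it from the tree's pieces:

* `stdPowRep F n τ d`, `stdPowLie` — `(ℂⁿ)^{⊗d}` with `G_∞` acting through the continuous
  real-algebra morphism `τ̃ : F_∞ → ℂ` extending `τ` (`embeddingExt`, `phiStdRep`,
  `PiTensor.piRep`);
  `stdPowRep_apply` (it is the tree's `glTensorRep` through `GL_n(τ̃)`), `weylModule_le_comap`
  (the Weyl module `S_μ(ℂⁿ)` is `G_∞`-stable), `isDifferentiableRep_stdPow`;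
* `factorRep F n wt τ = V_wt(ℂ) ∘ GL_n(τ̃)` (`GLnCohomology.coeffRepGL` pulled back along `τ̃`),
  `weylFactorRep`, `factorRep_eq` (**it is the `det^{λ_{n−1}} ∘ τ̃`-twist of the Weyl
  sub-representation**), its differential `factorLie`, and `isDifferentiableRep_factor`;
* `archCoeffRep F n wt : Representation ℂ G_∞ (ParallelWeight.CoeffModule ℂ F n wt)` — **the
  archimedean coefficient module `E_wt(ℂ)`, `g ↦ ⨂_τ V_wt(τ̃ g)`**, its Leibniz differential
  `archCoeffLie`, `isDifferentiableRep_archCoeff`, and `isGKModule_archCoeff` — **`E_wt(ℂ)` is a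
  `(𝔤, K_∞)`-module** [cite: BorelWallach2000, 0 §2.3–2.5; VII §2 (2.2), the module `(ρ, E)`];
* `diagArch F n : GL_n(F) →* G_∞` (entries through the mixed embedding) and
  `archCoeffRep_diagArch` — **on `GL_n(F)` it is the Betti coefficient representation
  `ParallelWeight.coeffRep ℂ F n wt`** (`τ̃ ∘ ι_∞ = τ`) [cite: Harder1987, §1.1 (the sheaves `M̃`)].

## Mathlib / Literature search

Tree: `GLnCohomology.coeffRepGL/CoeffModule/weylRepCoeff` (`CuspidalCohomologyGL`), `weylModule`,
`glTensorRep_mem_weylModule`, `coe_weylRep_apply` (`SchurWeylPlethysm`), `ParallelWeight.coeffRep`,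
`coeffRep_apply_tprod` (`BianchiOrdinaryClassicality`), `archGroupGL` (`AdelicGLnGlue`), and the
`GKModule*` files imported.  `lean search 'archCoeff|coeffRep.*arch'`: nothing prior.

## References

* A. Borel, N. Wallach (2000), 0 §2.3–2.5 and VII §2 (Thm. 2.2) (held) [BorelWallach2000].
* G. Harder, Invent. Math. 89 (1987), §1.1 [Harder1987].
-/

noncomputable section

namespace Literature.NumberTheory.Automorphic

open Module
open scoped TensorProduct

-- Mathlib idiom (as in `GKModules`): commutator bracket on `Module.End`
attribute [local instance 100] LieRing.ofAssociativeRing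

namespace ParallelWeight

open RealMatrixGroup Literature.NumberTheory.DiophantineGeometry _root_.NumberField
  _root_.NumberField.mixedEmbedding
-- `Classical`: the place subtypes indexing `mixedSpace F` are `Fintype` classically (as in
-- `AdelicGLnGlue`); it also supplies `DecidableEq (F →+* ℂ)` for the Leibniz differential.
open scoped MatrixGroups Classical

variable (F : Type) [Field F] [NumberField F] (n : ℕ) (wt : Fin n → ℤ)

/-! #### One embedding: `V_wt(ℂ) ∘ GL_n(τ̃)` -/

section Factor

variable (τ : F →+* ℂ)

/-- The tensor power `(ℂⁿ)^{⊗d}` with `G_∞ = GL_n(F_∞)` acting through `τ̃ : F_∞ → ℂ` in each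
factor (`PiTensor.piRep` of `d` copies of the `τ̃`-standard representation).
[cite: BorelWallach2000, 0 §2.3] -/
def stdPowRep (d : ℕ) :
    Representation ℂ (archGroupGL n F).carrier (TensorPower ℂ d (Fin n → ℂ)) :=
  PiTensor.piRep (archGroupGL n F) fun _ : Fin d => phiStdRep (archGroupGL n F) (embeddingExt τ)

/-- Its Leibniz differential. [cite: BorelWallach2000, 0 §2.3] -/
def stdPowLie (d : ℕ) :
    (archGroupGL n F).lie →ₗ⁅ℝ⁆ Module.End ℂ (TensorPower ℂ d (Fin n → ℂ)) :=
  PiTensor.piLie (archGroupGL n F) fun _ : Fin d => phiStdLie (archGroupGL n F) (embeddingExt τ)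

/-- `stdPowRep` is the tree's `glTensorRep` (diagonal action on the tensor power) through
`GL_n(τ̃)`. [folklore] -/
theorem stdPowRep_apply (d : ℕ) (g : (archGroupGL n F).carrier) :
    stdPowRep F n τ d g = glTensorRep (Fin n) ℂ d
      (Matrix.GeneralLinearGroup.map (embeddingExt τ : mixedSpace F →+* ℂ) (g : GL (Fin n) _)) := by
  refine PiTensorProduct.ext (MultilinearMap.ext fun v => ?_)
  simp only [LinearMap.compMultilinearMap_apply, stdPowRep, PiTensor.piRep_tprod, phiStdRep_apply,
    glTensorRep_tprod]
  rfl

/-- The Weyl module `S_μ(ℂⁿ) ⊆ (ℂⁿ)^{⊗d}` is `G_∞`-stable. [folklore] -/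
theorem weylModule_le_comap {d : ℕ} (μ : Nat.Partition d) (g : (archGroupGL n F).carrier) :
    weylModule ℂ (Fin n) μ ≤ (weylModule ℂ (Fin n) μ).comap (stdPowRep F n τ d g) := by
  intro x hx
  rw [Submodule.mem_comap, stdPowRep_apply]
  exact glTensorRep_mem_weylModule ℂ (Fin n) μ _ hx

/-- `(ℂⁿ)^{⊗d}` through `τ̃` is a differentiable representation of `G_∞`.
[cite: BorelWallach2000, 0 §2.3] -/
theorem isDifferentiableRep_stdPow (d : ℕ) :
    IsDifferentiableRep (archGroupGL n F) (stdPowRep F n τ d) (stdPowLie F n τ d) :=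
  PiTensor.isDifferentiableRep (archGroupGL n F) _ _ fun _ =>
    isDifferentiableRep_phiStd (archGroupGL n F) (embeddingExt τ) (continuous_embeddingExt τ)

/-- **The factor `V_wt(ℂ) ∘ GL_n(τ̃)`**: the algebraic representation `V_wt = S_μ ⊗ det^{λ_{n−1}}`
(`GLnCohomology.coeffRepGL`) of `GL_n(ℂ)` pulled back to `G_∞ = GL_n(F_∞)` along `τ̃`.
[cite: Harder1987, §1.1] -/
def factorRep : Representation ℂ (archGroupGL n F).carrier (GLnCohomology.CoeffModule ℂ n wt) :=
  (GLnCohomology.coeffRepGL ℂ n wt).comp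
    ((Matrix.GeneralLinearGroup.map (embeddingExt τ : mixedSpace F →+* ℂ)).comp
      (archGroupGL n F).carrier.subtype)

/-- Unfolding. [folklore] -/
theorem factorRep_apply (g : (archGroupGL n F).carrier) (w : GLnCohomology.CoeffModule ℂ n wt) :
    factorRep F n wt τ g w = GLnCohomology.coeffRepGL ℂ n wt
      (Matrix.GeneralLinearGroup.map (embeddingExt τ : mixedSpace F →+* ℂ) (g : GL (Fin n) _)) w :=
  rfl

/-- Its differential: the Leibniz differential restricted to the Weyl module, plus
`λ_{n−1} · tr ∘ τ̃`. [cite: BorelWallach2000, 0 §2.3] -/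
def factorLie : (archGroupGL n F).lie →ₗ⁅ℝ⁆ Module.End ℂ (GLnCohomology.CoeffModule ℂ n wt) :=
  twistLie (E := GLnCohomology.CoeffModule ℂ n wt) (archGroupGL n F)
    (show (archGroupGL n F).lie →ₗ⁅ℝ⁆ Module.End ℂ (GLnCohomology.CoeffModule ℂ n wt) from
      GKSubmodule.subLie (archGroupGL n F) (stdPowLie F n τ (GLnCohomology.coeffDegree wt))
        (weylModule ℂ (Fin n) (GLnCohomology.coeffPartition wt))
        ((isDifferentiableRep_stdPow F n τ _).le_comap_of_stable (weylModule_le_comap F n τ _)))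
    (detCharLie (archGroupGL n F) (embeddingExt τ) (GLnCohomology.lowestEntry wt))

/-- The Weyl sub-representation of `stdPowRep`, typed on `V_wt(ℂ)` (as the tree's
`GLnCohomology.weylRepCoeff`). [folklore] -/
def weylFactorRep : Representation ℂ (archGroupGL n F).carrier (GLnCohomology.CoeffModule ℂ n wt) :=
  show Representation ℂ (archGroupGL n F).carrier
      ↥(weylModule ℂ (Fin n) (GLnCohomology.coeffPartition wt)) from
    (stdPowRep F n τ (GLnCohomology.coeffDegree wt)).subrepresentation
      (weylModule ℂ (Fin n) (GLnCohomology.coeffPartition wt)) (weylModule_le_comap F n τ _)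

/-- `factorRep` is the `det^{λ_{n−1}} ∘ τ̃`-twist of the Weyl sub-representation of `stdPowRep`.
[folklore] -/
theorem factorRep_eq :
    factorRep F n wt τ = twist (archGroupGL n F) (weylFactorRep F n wt τ)
      (detChar (archGroupGL n F) (embeddingExt τ) (GLnCohomology.lowestEntry wt)) := by
  refine MonoidHom.ext fun g => LinearMap.ext fun w => ?_
  rw [factorRep_apply, GLnCohomology.coeffRepGL_apply, twist_apply, detChar_apply,
    Units.val_zpow_eq_zpow_val]
  congr 1

/-- The Weyl factor is differentiable (sub-representation of `stdPowRep`).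
[cite: BorelWallach2000, 0 §2.3] -/
theorem isDifferentiableRep_weylFactor :
    IsDifferentiableRep (archGroupGL n F) (weylFactorRep F n wt τ)
      (show (archGroupGL n F).lie →ₗ⁅ℝ⁆ Module.End ℂ (GLnCohomology.CoeffModule ℂ n wt) from
        GKSubmodule.subLie (archGroupGL n F) (stdPowLie F n τ (GLnCohomology.coeffDegree wt))
          (weylModule ℂ (Fin n) (GLnCohomology.coeffPartition wt))
          ((isDifferentiableRep_stdPow F n τ _).le_comap_of_stable
            (weylModule_le_comap F n τ _))) :=
  (isDifferentiableRep_stdPow F n τ _).subrepresentation (weylModule_le_comap F n τ _)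

/-- **`V_wt(ℂ) ∘ GL_n(τ̃)` is a differentiable representation of `G_∞`**, with differential
`factorLie`. [cite: BorelWallach2000, 0 §2.3] -/
theorem isDifferentiableRep_factor :
    IsDifferentiableRep (archGroupGL n F) (factorRep F n wt τ) (factorLie F n wt τ) := by
  rw [factorRep_eq]
  exact (isDifferentiableRep_weylFactor F n wt τ).twist
    (isDifferentiableRep_detChar (archGroupGL n F) (embeddingExt τ) _ (continuous_embeddingExt τ))

end Factor

/-! #### All embeddings: `E_wt(ℂ) = ⨂_τ V_wt(ℂ) ∘ GL_n(τ̃)` -/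

open scoped Classical in
/-- **The archimedean coefficient module `E_wt(ℂ)`**: the representation
`g ↦ ⨂_{τ : F → ℂ} V_wt(τ̃(g))` of `G_∞ = GL_n(F_∞)` on `⨂_τ V_wt(ℂ)`
(`ParallelWeight.CoeffModule ℂ F n wt`). [cite: BorelWallach2000, VII §2 (2.2)] -/
def archCoeffRep : Representation ℂ (archGroupGL n F).carrier (CoeffModule ℂ F n wt) :=
  show Representation ℂ (archGroupGL n F).carrier
      (⨂[ℂ] _τ : (F →+* ℂ), GLnCohomology.CoeffModule ℂ n wt) from
    PiTensor.piRep (archGroupGL n F) fun τ => factorRep F n wt τ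

open scoped Classical in
/-- Its Leibniz differential. [cite: BorelWallach2000, 0 §2.3] -/
def archCoeffLie : (archGroupGL n F).lie →ₗ⁅ℝ⁆ Module.End ℂ (CoeffModule ℂ F n wt) :=
  show (archGroupGL n F).lie →ₗ⁅ℝ⁆
      Module.End ℂ (⨂[ℂ] _τ : (F →+* ℂ), GLnCohomology.CoeffModule ℂ n wt) from
    PiTensor.piLie (archGroupGL n F) fun τ => factorLie F n wt τ

open scoped Classical in
/-- Unfolding on pure tensors. [folklore] -/
theorem archCoeffRep_apply_tprod (g : (archGroupGL n F).carrier)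
    (v : (F →+* ℂ) → GLnCohomology.CoeffModule ℂ n wt) :
    archCoeffRep F n wt g (PiTensorProduct.tprod ℂ v) =
      PiTensorProduct.tprod ℂ fun τ => factorRep F n wt τ g (v τ) :=
  PiTensor.piRep_tprod (archGroupGL n F) _ g v

/-- `V_wt(ℂ)` is finite-dimensional (a subspace of a tensor power of `ℂⁿ`). [folklore] -/
theorem finiteDimensional_coeffModule :
    FiniteDimensional ℂ (GLnCohomology.CoeffModule ℂ n wt) :=
  inferInstanceAs (FiniteDimensional ℂ ↥(weylModule ℂ (Fin n) (GLnCohomology.coeffPartition wt)))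

open scoped Classical in
/-- **`E_wt(ℂ)` is a differentiable representation of `G_∞`** (Leibniz differential).
[cite: BorelWallach2000, 0 §2.3] -/
theorem isDifferentiableRep_archCoeff :
    IsDifferentiableRep (archGroupGL n F) (archCoeffRep F n wt) (archCoeffLie F n wt) := by
  haveI : ∀ _τ : F →+* ℂ, FiniteDimensional ℂ (GLnCohomology.CoeffModule ℂ n wt) :=
    fun _ => finiteDimensional_coeffModule n wt
  exact PiTensor.isDifferentiableRep (archGroupGL n F) _ _ fun τ =>
    isDifferentiableRep_factor F n wt τ

open scoped Classical in
/-- **`E_wt(ℂ)`, restricted to `K_∞`, with its Leibniz differential, is a `(𝔤, K_∞)`-module** —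
the coefficient `(𝔤, K∞)`-module of the relative Lie algebra cohomology
`H^•(𝔤, K_∞; π_∞ ⊗ E_wt)` (`AutomorphicRepCohomologyCoeff`). [cite: BorelWallach2000, 0 §2.4–2.5] -/
theorem isGKModule_archCoeff :
    IsGKModule (archGroupGL n F) (restrictK (archGroupGL n F) (archCoeffRep F n wt))
      (archCoeffLie F n wt) := by
  haveI : ∀ _τ : F →+* ℂ, FiniteDimensional ℂ (GLnCohomology.CoeffModule ℂ n wt) :=
    fun _ => finiteDimensional_coeffModule n wt
  haveI : FiniteDimensional ℂ (CoeffModule ℂ F n wt) :=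
    inferInstanceAs (FiniteDimensional ℂ (⨂[ℂ] _τ : (F →+* ℂ), GLnCohomology.CoeffModule ℂ n wt))
  exact (isDifferentiableRep_archCoeff F n wt).isGKModule

/-! #### Restriction to `GL_n(F)`: the Betti coefficients -/

/-- `GL_n(F) → G_∞ = GL_n(F_∞)` (entries through the mixed embedding `ι_∞ : F → F_∞`). [folklore] -/
def diagArch : GL (Fin n) F →* (archGroupGL n F).carrier :=
  (Matrix.GeneralLinearGroup.map (mixedEmbedding F : F →+* mixedSpace F)).codRestrict
    (archGroupGL n F).carrier fun _ => Subgroup.mem_top _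

/-- Unfolding. [folklore] -/
theorem coe_diagArch (g : GL (Fin n) F) :
    ((diagArch F n g : (archGroupGL n F).carrier) : GL (Fin n) (mixedSpace F)) =
      Matrix.GeneralLinearGroup.map (mixedEmbedding F : F →+* mixedSpace F) g :=
  rfl

/-- `GL_n(τ̃) ∘ GL_n(ι_∞) = GL_n(τ)`. [folklore] -/
theorem map_embeddingExt_diagArch (τ : F →+* ℂ) (g : GL (Fin n) F) :
    Matrix.GeneralLinearGroup.map (embeddingExt τ : mixedSpace F →+* ℂ)
        ((diagArch F n g : (archGroupGL n F).carrier) : GL (Fin n) (mixedSpace F)) =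
      Matrix.GeneralLinearGroup.map τ g := by
  rw [coe_diagArch, ← MonoidHom.comp_apply, ← Matrix.GeneralLinearGroup.map_comp,
    embeddingExt_comp_mixedEmbedding]

open scoped Classical in
/-- **On `GL_n(F) ⊆ G_∞` the archimedean coefficient module is the Betti coefficient
representation `ParallelWeight.coeffRep ℂ F n wt = ⨂_τ V_wt(ℂ) ∘ GL_n(τ)`** (`τ̃ ∘ ι_∞ = τ`).
[cite: Harder1987, §1.1] -/
theorem archCoeffRep_diagArch (g : GL (Fin n) F) :
    archCoeffRep F n wt (diagArch F n g) = coeffRep ℂ F n wt g := by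
  refine PiTensorProduct.ext (MultilinearMap.ext fun v => ?_)
  simp only [LinearMap.compMultilinearMap_apply]
  change archCoeffRep F n wt (diagArch F n g) (PiTensorProduct.tprod ℂ v) =
    coeffRep ℂ F n wt g (PiTensorProduct.tprod ℂ v)
  rw [archCoeffRep_apply_tprod, coeffRep_apply_tprod]
  congr 1
  funext τ
  rw [factorRep_apply, map_embeddingExt_diagArch]

end ParallelWeight

end Literature.NumberTheory.Automorphic
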